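import Literature.NumberTheory.EllipticCurves.Castella2018.AnticyclotomicMainConjectureErratumReoriented
import Literature.NumberTheory.EllipticCurves.Skinner2016.HidaCongruentMembers
import Literature.NumberTheory.EllipticCurves.SigmaEulerData
import HarnessLib

/-!
# Castella's erratum, proof of Thm. 1.1 (p. 4): the Hida MEMBERS `g_m ≡ f_E (mod p^m)` carry (b) the Galois
# congruence, (2.5)_m the divisibility `Ch_{Λ_𝒪}(X^Σ_ac(A_{g_m}))Λ_𝒪^ur ⊂ (L^Σ_p(g_m))` (Thm. 2.3, via
# Fouquet–Wan Thm. 4.41, UNREFEREED) and (c) the congruence `(L^Σ_p(g_m), p^m) = (L^Σ_p(f), p^m)` — ONE OPEN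
# hypothesis bundling the member data of the "Road FF", frame at `(ι, 𝔭)`, Selmer slot at `𝔭̄`

Cell `bsd-stepL` (run/shared/lean/pub/bsd-stepL/), typer lane `bsd-stepL-defn-ty1` (g3; design memo
HOME/defn-ty1/MEMBER-FACTS-DESIGN-defn-ty1-g2.md, option (r3), ACKed by the consumer imc-p1 g9, STATUS
2026-08-27T05:25:40Z). Consumer: the deciding stub `stub_roadFF_fittingCongruenceFrameB` of crux
`stmt-BirchSwinnertonDyer-20169` (`IMCDivAtErratumDataAllR`) through
`P2.RoadFF.fittingCongruenceFrameTwoSlotAt_of_members_descent_le_printed` (binders `Nm`, `Lm`, `hCh`, `hc`,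
`e`; the binder `e` is KERNEL from (b) = `Skinner2016.HidaCongruentMember.exists_equivariant_equiv`,
`Skinner2016.selmerBig_extendScalars_equiv_baseChange`, `GreenbergSelmer.exists_frobeniusData_padicCoeffIntegers`).
HONEST FRAMING: an UNREFEREED step (erratum (2.4) ⇒ (2.5) rests on [FouquetWan2021, Thm. 4.41], a preprint)
enters the tree ONLY as an explicitly labelled OPEN hypothesis (`def … _OPEN : Prop`, `[claim: …]`), never as a
theorem; every result using it is CONDITIONAL; nothing about any curve is asserted. ONE new named `Prop`
(D-0014: +1 unproved, claim-tagged) and small PROVED API; no `sorry`, no definition besides the `Prop`, no instance.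

## Source, verbatim ([Castella2018Erratum], held text `paper:url-e83251f1873d`, pp. 2–4)

§2 (p. 2): "let `g ∈ S_k(Γ₀(M))` be a `p`-ordinary newform of even weight `k ≥ 2` and level `M ≥ 3` with
`p ∤ M` defined over `𝒪` … `T_g ⊂ V_g` … `A_g := V_g/T_g` … `M_g := T_g ⊗_𝒪 Λ_𝒪^*` … `Sel^Σ_𝔭(K, M_g)`
following [Cas18, Def. 2.2]." (p. 3): "Write `X^Σ_ac(A_g) = Sel^Σ_𝔭(K, M_g)^*` … Suppose now that in
addition `K` satisfies the following Heegner hypothesis: there exists an ideal `𝔐 ⊂ 𝒪_K` with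
`𝒪_K/𝔐 ≃ ℤ/Mℤ`. … put `Λ_𝒪^ur = Λ_{R₀} ⊗_{ℤ_p} 𝒪`. **Theorem 2.3.** Let `g ∈ S_k(Γ₀(M))` be a
`p`-ordinary newform of weight `k ≥ 2` and level `M ≥ 3` with `p ∤ M`. Assume that: (i) `ρ̄_g|_{G_K}` is
irreducible. (ii) If `2` is nonsplit in `K`, then `2 ∥ M`. (iii) There is a prime `q ∥ M` which is nonsplit
in `K`. (iv) If `ℓ ∥ M` is nonsplit in `K`, then the local component `π(f)_ℓ` is the special representation
twisted by the unramified character sending `ℓ ↦ −ℓ^{k/2−1}`. If `Σ` is any finite set of primes `v ∤ p` of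
`K`, then `X^Σ_ac(A_g)` is `Λ_𝒪`-torsion, and `Ch_{Λ_𝒪}(X^Σ_ac(A_g))Λ_𝒪^ur = (L^Σ_p(g))`, where `L^Σ_p(g)`
is as in [Cas18, (5.1)]." Its proof (p. 4): "(2.3) `Ch_{Λ_𝒪}(X_ac(A_g))Λ_𝒪^ur ⊃ (L_p(g))` … Conversely …
**By [FW21, Thm. 4.41], we then have the divisibility (2.4)** `Ch_{Λ̃_𝒪}(X_K(A_g))Λ̃_𝒪^ur ⊂ (L^Gr_p(g))`
… Taking a `Σ` that contains all primes dividing `M`, by [JSW17, Cor. 3.4.2] it follows that (2.4) yields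
the divisibility **(2.5)** `Ch_{Λ_𝒪}(X^Σ_ac(A_g))Λ_𝒪^ur ⊂ (L^Σ_p(g))` in `Λ_𝒪^ur`." Proof of Theorem 1.1
(p. 4): "The result can now be deduced following the approach in [Ski16, § 3.1]. Put `M = N` if `p ∤ N`,
and `M = N/p` if `p ∥ N`. As in the proof of Theorem 2.3, it suffices to prove the result for
`X^Σ_ac(E[p^∞])` and `L^Σ_p(f)` for `Σ` a finite set of primes `v ∤ p` of `K` containing the primes dividing
`M`. **We claim that, after possibly enlarging `𝒪`, for each `m ≥ 1` there exists (a) a `p`-ordinary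
newform `g_m ∈ S_{k_m}(Γ₀(M))` defined over `𝒪` of weight `k_m > 2` with `k_m ≡ 2 (mod p − 1)`; (b) a
`G_ℚ`-stable lattice `T_{g_m} ⊂ V_{g_m}` and an isomorphism `T_{g_m}/p^m T_{g_m} ≃ T/p^m T` as
`𝒪[G_ℚ]`-modules; (c) an equality `(L^Σ_p(g_m), p^m) = (L^Σ_p(f), p^m) ⊂ Λ_𝒪^ur`. Indeed, (a) and (b)
follow from Hida theory (see the discussion in [Ski16, §2.6]), and (c) follows from [Cas20, Thm. 2.11]. By
Theorem 2.3¹, the module `X^Σ_ac(A_{g_m})` is `Λ_𝒪`-torsion, with `Ch_{Λ_𝒪}(X^Σ_ac(A_{g_m}))Λ_𝒪^ur =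
(L^Σ_p(g_m))`.**" Footnote 1: "the hypothesis that `ρ̄_{g_m} ≃ E[p]` is irreducible as a `G_ℚ`-module and
ramified at some prime `q ∥ N` nonsplit in `K` implies that `ρ̄_{g_m}|_{G_K}` is irreducible, see [Ski20,
Lem. 2.8.1]. Moreover, by 'rigidity of automorphic types' [FO12, Lem. 2.14], condition (iii) in Theorem 1.1
implies conditions (iii) and (iv) in Theorem 2.3." [Cas18, (3.1)] (author PDF p. 9): "`L^Σ_p(f) := L_p(f) ×
∏_{w∈Σ} P_w(…)`", `L_p(f)` the function of [Cas18, Thm. 3.1] (tree `IsBDPLFunction`); the erratum's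
"[Cas18, (5.1)]" is a slip for (3.1) — [Cas18] (5.1) is the formula for `#ℤ_p/f_ac(0)` (author PDF p. 13).
The input (2.4) is [FW21, Thm. 4.41] with [FW21, Cor. 7.21 and Lemma 7.22] (the erratum's "[FO12,
Cor. 7.2.1]" refers to [FW21, App. B]).

## Transcription (tree vocabulary only; nothing re-declared)

The binders are VERBATIM those of the tree's re-oriented Thm. 1.1 hypothesis
`Castella2018.erratumThm11Reoriented_exists_isBDPLFunction_isTorsion_charIdeal_eq_OPEN` (`W/ℚ` globally
minimal with newform `f` of level `N`, `3 < p`, `Mult W p`; `K` imaginary quadratic, Heegner for `N`, `p` split,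
`𝔭 ∋ p` singled out by the embedding datum `ι`, `𝔭bar ∋ p` the other prime; (i)–(iv); `κ` anticyclotomic with
topological generator `γ`), PLUS Thm. 2.3's level hypothesis for the members, `3 ≤ M = N/p` (flag
`Mem-M-ge-3`). CONCLUSION: there is a frame `(Ω_K ≠ 0, Ω_p ∈ R₀ˣ, L ∈ R₀⟦T⟧)` of `f` at `(ι, 𝔭)`
(`IsBDPLFunction`; [Cas18, Thm. 3.1]) such that for every `m ≥ 1` THERE IS a Hida member
`D : Skinner2016.HidaCongruentMember W p m` ((a)+(b): `g_m ∈ S_{k_m}(Γ₀(N/p))`, `k_m > 2`, `k_m ≡ 2 (p−1)`,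
`ι_m`-ordinary, `a_ℓ(g_m) ≡ a_ℓ(E) (p^m)`, integral ordinary datum `Δ` over its OWN ring
`𝒪_m = padicCoeffIntegers ι_m`, and the `𝒪_m[G_ℚ]`-isomorphism `A_{g_m}[p^m] ≃ (E[p^∞] ⊗ 𝒪_m)[p^m]`) with:
* (Thm. 2.3, torsion) `X^Σ_ac(A_{g_m}) := XBig κ (D.Δ.cofreeRepOver K) 𝔭bar Σ` is `Λ_{𝒪_m} = 𝒪_m⟦T⟧`-torsion,
  `Σ = Σ(W,p)(K)` = the places dividing `M`, not above `p` (`W.sigmaPlacesFinset p K`, the minimal allowed `Σ`);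
* for EVERY receptacle of `Λ_{𝒪_m}^ur = Λ_{R₀} ⊗_{ℤ_p} 𝒪_m` — any commutative ring `S₀` with ring maps
  `a : R₀ → S₀`, `b : 𝒪_m → S₀` agreeing on `ℤ_p` (structure map `j : ℤ_p → R₀`, characterised as in the
  re-oriented fact) — SOME `Lm ∈ S₀⟦T⟧` ("`L^Σ_p(g_m)`", read in `S₀⟦T⟧` along `Λ_{𝒪_m}^ur → S₀⟦T⟧`) with
  (2.5)_m: `Ch_{Λ_{𝒪_m}}(X^Σ_ac(A_{g_m}))·S₀⟦T⟧ ⊆ (Lm)` and (c): `(Lm) + (p^m) = (a(L·j(P_Σ))) + (p^m)`,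
  `P_Σ = W.sigmaEulerElement p K κ ∈ Λ` the `Σ`-Euler element of `E/K` ([Cas18, (3.1)]; file `SigmaEulerData`).

## Flags (nothing hidden; each makes the `Prop` WEAKER than or equal to print, never stronger)

* `Mem-r3` (FRAME-FREE): print's `L^Σ_p(g_m)` is a definite element (the twisted Castella–Hsieh measure of
  `g_m` times Euler factors, characterised by interpolation); here it is EXISTENTIAL and only its two printed
  ideal relations (2.5)_m, (c) are kept — the member's interpolation property is dropped (the tree's frame
  `IsBDPLFunctionWt` is `R₀⟦T⟧`-valued and cannot host `L_p(g_m)` when `𝒪_m ⊄ R₀`).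
* `Mem-receptacle`: print's `Λ_𝒪^ur = Λ_{R₀} ⊗_{ℤ_p} 𝒪`; every compatible pair `(a, b)` factors
  `Λ_𝒪^ur → S₀⟦T⟧`, and ideal inclusions/equalities map along ring maps, so the `∀ S₀` form is implied by print.
* `Mem-one-sided`: Thm. 2.3 prints an EQUALITY; only the torsion clause and the `⊂` half (2.5)_m — the half
  that rests on [FW21] and the half the Road FF consumes — are transcribed.
* `Mem-M-ge-3`: Thm. 2.3 is stated for level `M ≥ 3`; the proof of Thm. 1.1 applies it at `M = N/p` without
  restating this, so `3 ≤ N/p` is made an explicit hypothesis here (erratum data with `N = 2p` are NOT covered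
  by this `Prop`).
* `Mem-orient`: print's `X_ac` is [Cas18] Def. 2.2's dual STRICT at the prime of `ı_p`; for the tree's
  precomposition duals (`XBig`, like `AcSelmer.XAc`) the partner of the frame `IsBDPLFunction ι 𝔭` is the dual
  STRICT AT `𝔭bar` (bsd-eis RULING L33, cell RULINGS 1/4 of 2026-08-27; same layout as the re-oriented Thm. 1.1
  fact and `SkinnerUrban2014.prop323_XAc_equiv_XBigDecomp`'s consumers).
* `Mem-own-ring` / `Mem-per-m` / `Mem-A-side`: as F2 (`Skinner2016/HidaCongruentMembers.lean`): print has ONE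
  `𝒪 ⊇` all Hecke fields; here each member carries its own `𝒪_m` (Carayol rigidity), `∀ m ∃` instead of `∃ ∀ m`.
* `Mem-frame-existential`: the frame of `f` is produced (∃), not consumed (∀): (c) is printed for THE `L_p(f)`
  of [Cas18, Thm. 3.1], not for every series with its interpolation property.
* `Mem-top`: stated for every topology on `Λ_{𝒪_m}` making the action on the discrete module continuous
  (the groups do not depend on it), as in the tree's other facts on `XBig`.
STATUS: **PRE** — (a)(b) [Skinner2016PacificMC §2.6/§3.1] and (c) [Castella2020JIMJ Thm. 2.11 with Cas18 (4.1)]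
are refereed; (2.5)_m rests on [FouquetWan2021, Thm. 4.41] (arXiv:2107.13726, unrefereed) + [JSW17, Cor. 3.4.2]
+ [CGS23, Prop. 2.4.5] + [Hsi14, Thm. B]; the erratum itself is unrefereed. NEVER cite this `Prop` as a theorem.

## References

* [Castella2018Erratum] §2 (p. 2), Thm. 2.3 and (2.3)–(2.5) (pp. 3–4), proof of Thm. 1.1 (a)(b)(c) and
  footnote 1 (p. 4). [Castella2024] arXiv:2409.01360v1 Thm. 3.1.
* [FouquetWan2021] O. Fouquet, X. Wan, arXiv:2107.13726, Thm. 4.41 (the source of (2.4); PREPRINT).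
* [Castella2020JIMJ] F. Castella, J. Inst. Math. Jussieu 19 (2020), Def. 2.10, Thm. 2.11 ((c)).
* [Castella2018] Camb. J. Math. 6 (2018), Def. 2.2, Thm. 3.1, (3.1) (p. 9), (4.1); ((5.1), p. 13, is
  `#ℤ_p/f_ac(0)` — cited by the erratum by a slip for (3.1)).
* [Skinner2016PacificMC] §2.6 (2-6-1), §3.1 (a)(b) (p. 191) ((a)(b); tree F2 `HidaCongruentMembers`).
* [FouquetWan2021] also Cor. 7.21, Lemma 7.22 (inputs of (2.5)_m with Thm. 4.41).
* [JetchevSkinnerWan2017] Cor. 3.4.2, Thm. 6.1.6; [FouquetOchiai2012] Lem. 2.14; [Skinner2020] Lem. 2.8.1.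
* Tree: `Castella2018/AnticyclotomicMainConjectureErratumReoriented.lean` (binders), `Skinner2016/
  HidaCongruentMembers.lean` (F2), `BigGaloisRepSelmer.lean` (`XBig`, `XBig.charIdeal`), `SigmaEulerData.lean`
  (`sigmaPlacesFinset`, `sigmaEulerElement`), `BDPAnticyclotomicPAdicLFunction.lean` (`IsBDPLFunction`,
  `unrIntegers`, `UnrSeries`); Summits consumer `Theorems/ErratumRoadFiveIMCDivRoadFFFittingCutB.lean`.
-/

noncomputable section

open scoped Classical

open PowerSeries WeierstrassCurve NumberField IsDedekindDomain Field
  Literature.NumberTheory.EllipticCurves Literature.NumberTheory.EllipticCurves.ModularForms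
  Literature.NumberTheory.EllipticCurves.Rank1Residual Literature.NumberTheory.EllipticCurves.BigGaloisRep
  Literature.NumberTheory.EllipticCurves.GreenbergSelmer Literature.NumberTheory.GaloisRepresentations

namespace Literature.NumberTheory.EllipticCurves.Castella2018

/-! ### §1 The OPEN fact -/

section Fact

/-- **OPEN HYPOTHESIS — the MEMBER PACKAGE of Castella's erratum, proof of Thm. 1.1 (p. 4): (a)+(b) Hida
members with their Galois congruence [Ski16 §2.6/§3.1], Thm. 2.3 for each member — `X^Σ_ac(A_{g_m})`
torsion and (2.5)_m `Ch_{Λ_𝒪}(X^Σ_ac(A_{g_m}))Λ_𝒪^ur ⊂ (L^Σ_p(g_m))` [via FW21 Thm. 4.41, UNREFEREED] — and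
(c) `(L^Σ_p(g_m), p^m) = (L^Σ_p(f), p^m)` [Cas20 Thm. 2.11], FRAME-FREE (option (r3)), frame of `f` at
`(ι, 𝔭)`, Selmer slot at `𝔭bar`.** Verbatim source, transcription and the flags `Mem-r3`, `Mem-receptacle`,
`Mem-one-sided`, `Mem-M-ge-3`, `Mem-orient`, `Mem-own-ring`, `Mem-per-m`, `Mem-A-side`,
`Mem-frame-existential`, `Mem-top`: module docstring. Binders before the conclusion = those of
`erratumThm11Reoriented_exists_isBDPLFunction_isTorsion_charIdeal_eq_OPEN`, verbatim, plus `3 ≤ N / p`.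
NEVER cite this `Prop` as a theorem: take it as an explicit hypothesis; a result using it is conditional on
unrefereed claims (the erratum; arXiv:2107.13726 Thm. 4.41 via erratum (2.4)).
[claim: Castella2018Erratum, status: under-review]
[claim: FouquetWan2021, status: under-review]
[cite: Castella2020JIMJ, Thm. 2.11 and Def. 2.10 ((c): "(c) follows from [Cas20, Thm. 2.11]")]
[cite: Skinner2016PacificMC, §2.6 (2-6-1) and §3.1 (a)(b) (p. 191) ((a)(b))]
[cite: Castella2018, Def. 2.2, Thm. 3.1 and (3.1) (p. 9) (the objects `X^Σ_ac`, `L_p(f)`, `L^Σ_p`; shape only, nothing asserted; the erratum's "(5.1)" is a slip for (3.1))] -/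
def erratum_members_exists_isTorsion_charIdeal_le_congruence_OPEN : Prop :=
  ∀ {p : ℕ} [Fact p.Prime] (ι : PadicAlgCl p ≃+* ℂ) (W : WeierstrassCurve ℚ) [W.IsElliptic]
    [W.IsGloballyMinimal] (K : Type) [Field K] [NumberField K]
    (𝔭 𝔭bar : HeightOneSpectrum (𝓞 K)) (κ : ZpExtension K p) (γ : absoluteGaloisGroup K)
    [Fact (κ.IsTopGenerator γ)] {N : ℕ} [NeZero N] {f : CuspForm (CongruenceSubgroup.Gamma0 N) 2}
    (_ : IsNewformOf W f),
    -- "`E/ℚ` an elliptic curve of conductor `N` with multiplicative reduction at `p > 3`"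
    W.conductorNorm ℤ = N → 3 < p → Mult W p →
    -- Thm. 2.3: "level `M ≥ 3`" for the members `g_m ∈ S_{k_m}(Γ₀(M))`, `M = N/p` (flag `Mem-M-ge-3`)
    3 ≤ N / p →
    -- "`K` imaginary quadratic … `𝒪_K/𝔑 ≃ ℤ/Nℤ` … in which `p = 𝔭𝔭̄` splits"
    IsImaginaryQuadratic K → (∃ β : ℤ, (4 * N : ℤ) ∣ β ^ 2 - NumberField.discr K) →
    ((Ideal.span {(p : ℤ)}).primesOver (𝓞 K)).ncard = 2 →
    -- `𝔭 ∋ p` induced by the embedding datum `ι` (through which the frame reads infinity types)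
    ((p : ℕ) : 𝓞 K) ∈ 𝔭.asIdeal →
    (∀ (w : InfinitePlace K) (k : 𝓞 K), k ∈ 𝔭.asIdeal ↔ ‖ι.symm (w.embedding (k : K))‖ < 1) →
    -- `𝔭bar ∋ p` THE OTHER prime above `p` (the Selmer slot; flag `Mem-orient`)
    ((p : ℕ) : 𝓞 K) ∈ 𝔭bar.asIdeal → 𝔭bar ≠ 𝔭 →
    -- (i) `E[p]` irreducible
    Irr W p →
    -- (ii) "if `2` is nonsplit in `K`, then `2 ∥ N`"
    (((Ideal.span {(2 : ℤ)}).primesOver (𝓞 K)).ncard ≠ 2 → Mult W 2) →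
    -- (iii) nonsplit multiplicative at every `q ∥ N` nonsplit in `K`; one such `q` with `E[p]` ramified
    (∀ (q : ℕ) [Fact q.Prime], Mult W q → ((Ideal.span {(q : ℤ)}).primesOver (𝓞 K)).ncard ≠ 2 →
      ¬ W.HasSplitMultiplicativeReductionAtPrime q) →
    (∃ (q : ℕ) (_ : Fact q.Prime), Mult W q ∧ ((Ideal.span {(q : ℤ)}).primesOver (𝓞 K)).ncard ≠ 2 ∧
      ¬ p ∣ padicValInt q W.minimalDiscriminantInt) →
    -- (iv) `E(ℚ_p)[p] = 0`
    (∀ P : (W.baseChange ℚ_[p]).toAffine.Point, p • P = 0 → P = 0) →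
    -- `Γ = Gal(K_∞/K)` THE anticyclotomic `ℤ_p`-extension
    κ.IsAnticyclotomic →
    -- a frame of `f` at `(ι, 𝔭)` [Cas18 Thm. 3.1] … (flag `Mem-frame-existential`)
    ∃ (ΩK : ℂ) (Ωp : (unrIntegers p)ˣ) (L : UnrSeries p),
      ΩK ≠ 0 ∧ IsBDPLFunction ι 𝔭 κ γ f ΩK ((Ωp : unrIntegers p) : ℂ_[p]) L ∧
      -- … and for every `m ≥ 1` a member (a)+(b) …
      ∀ m : ℕ, 1 ≤ m →
        ∃ D : Skinner2016.HidaCongruentMember W p m,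
          ∀ [TopologicalSpace (PowerSeries (padicCoeffIntegers D.ι))]
            [ContinuousSMul (PowerSeries (padicCoeffIntegers D.ι))
              (BigRepModule (padicCoeffIntegers D.ι) p (Cofree D.Δ.ρ (padicCoeffField D.ι)))],
          -- Thm. 2.3 (torsion): `X^Σ_ac(A_{g_m})` is `Λ_{𝒪_m}`-torsion, `Σ = Σ(W,p)(K)`, slot `𝔭bar`
          Module.IsTorsion (PowerSeries (padicCoeffIntegers D.ι))
              (XBig κ (D.Δ.cofreeRepOver K) 𝔭bar (↑(W.sigmaPlacesFinset p K))) ∧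
          -- … in every receptacle `S₀` of `Λ_{𝒪_m}^ur = Λ_{R₀} ⊗_{ℤ_p} 𝒪_m` (flag `Mem-receptacle`):
          ∀ (S₀ : Type) [CommRing S₀] (a : unrIntegers p →+* S₀) (b : padicCoeffIntegers D.ι →+* S₀)
            (j : ℤ_[p] →+* unrIntegers p),
            (∀ x : ℤ_[p], ((j x : unrIntegers p) : ℂ_[p]) = algebraMap ℚ_[p] ℂ_[p] (x : ℚ_[p])) →
            a.comp j = b.comp (algebraMap ℤ_[p] (padicCoeffIntegers D.ι)) →
            ∃ Lm : PowerSeries S₀,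
              -- (2.5)_m: `Ch_{Λ_{𝒪_m}}(X^Σ_ac(A_{g_m}))·S₀⟦T⟧ ⊆ (L^Σ_p(g_m))` [FW21 4.41 — UNREFEREED]
              (XBig.charIdeal κ (D.Δ.cofreeRepOver K) 𝔭bar (↑(W.sigmaPlacesFinset p K))).map
                  (PowerSeries.map b) ≤ Ideal.span {Lm} ∧
              -- (c): `(L^Σ_p(g_m), p^m) = (L^Σ_p(f), p^m)`, `L^Σ_p(f) = L_p(f)·P_Σ` [Cas20 2.11, Cas18 (3.1)]
              Ideal.span {Lm} ⊔ Ideal.span {((p : ℕ) : PowerSeries S₀) ^ m} =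
                Ideal.span {PowerSeries.map a (L * PowerSeries.map j (W.sigmaEulerElement p K κ))} ⊔
                  Ideal.span {((p : ℕ) : PowerSeries S₀) ^ m}

end Fact

/-! ### §2 API (proved): the one-sided congruence shape the Road-FF consumer takes -/

section API

variable {p : ℕ} [Fact p.Prime] (ι : PadicAlgCl p ≃+* ℂ) (W : WeierstrassCurve ℚ) [W.IsElliptic]
  [W.IsGloballyMinimal] (K : Type) [Field K] [NumberField K] (𝔭 𝔭bar : HeightOneSpectrum (𝓞 K))
  (κ : ZpExtension K p) (γ : absoluteGaloisGroup K) [Fact (κ.IsTopGenerator γ)] {N : ℕ} [NeZero N]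
  {f : CuspForm (CongruenceSubgroup.Gamma0 N) 2} (hf : IsNewformOf W f)
  (hN : W.conductorNorm ℤ = N) (hp : 3 < p) (hmult : Mult W p) (hM : 3 ≤ N / p) (hK : IsImaginaryQuadratic K)
  (hHeeg : ∃ β : ℤ, (4 * N : ℤ) ∣ β ^ 2 - NumberField.discr K)
  (hsplit : ((Ideal.span {(p : ℤ)}).primesOver (𝓞 K)).ncard = 2)
  (h𝔭 : ((p : ℕ) : 𝓞 K) ∈ 𝔭.asIdeal)
  (hcompat : ∀ (w : InfinitePlace K) (k : 𝓞 K),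
    k ∈ 𝔭.asIdeal ↔ ‖ι.symm (w.embedding (k : K))‖ < 1)
  (h𝔭bar : ((p : ℕ) : 𝓞 K) ∈ 𝔭bar.asIdeal) (hne : 𝔭bar ≠ 𝔭)
  (hirr : Irr W p) (h2 : ((Ideal.span {(2 : ℤ)}).primesOver (𝓞 K)).ncard ≠ 2 → Mult W 2)
  (hns : ∀ (q : ℕ) [Fact q.Prime], Mult W q →
    ((Ideal.span {(q : ℤ)}).primesOver (𝓞 K)).ncard ≠ 2 → ¬ W.HasSplitMultiplicativeReductionAtPrime q)
  (hram : ∃ (q : ℕ) (_ : Fact q.Prime), Mult W q ∧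
    ((Ideal.span {(q : ℤ)}).primesOver (𝓞 K)).ncard ≠ 2 ∧ ¬ p ∣ padicValInt q W.minimalDiscriminantInt)
  (htors : ∀ P : (W.baseChange ℚ_[p]).toAffine.Point, p • P = 0 → P = 0)
  (hκ : κ.IsAnticyclotomic)

include hf hN hp hmult hM hK hHeeg hsplit h𝔭 hcompat h𝔭bar hne hirr h2 hns hram htors hκ

set_option maxHeartbeats 800000 in
/-- **The consumer's shape: a frame of `f` at `(ι, 𝔭)` and, for every `m ≥ 1`, a member with `N_m`
torsion, `Ch(N_m)·S₀⟦T⟧ ⊆ (L_m)` and the ONE-SIDED congruence `(L_m) ⊆ (L·j(P_Σ)) + (p^m)`** (binders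
`hCh`, `hc` of `P2.RoadFF.fittingCongruenceFrameTwoSlotAt_of_members_descent_le_printed`, with `(c)` weakened
from `=` to `≤` by `le_sup_left`). CONDITIONAL on the OPEN fact; nothing asserted.
[claim: Castella2018Erratum, status: under-review] [claim: FouquetWan2021, status: under-review] -/
theorem exists_frame_members_charIdeal_le_congruence_le_of_OPEN
    (h : erratum_members_exists_isTorsion_charIdeal_le_congruence_OPEN) :
    ∃ (ΩK : ℂ) (Ωp : (unrIntegers p)ˣ) (L : UnrSeries p),
      ΩK ≠ 0 ∧ IsBDPLFunction ι 𝔭 κ γ f ΩK ((Ωp : unrIntegers p) : ℂ_[p]) L ∧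
      ∀ m : ℕ, 1 ≤ m →
        ∃ D : Skinner2016.HidaCongruentMember W p m,
          ∀ [TopologicalSpace (PowerSeries (padicCoeffIntegers D.ι))]
            [ContinuousSMul (PowerSeries (padicCoeffIntegers D.ι))
              (BigRepModule (padicCoeffIntegers D.ι) p (Cofree D.Δ.ρ (padicCoeffField D.ι)))],
          Module.IsTorsion (PowerSeries (padicCoeffIntegers D.ι))
              (XBig κ (D.Δ.cofreeRepOver K) 𝔭bar (↑(W.sigmaPlacesFinset p K))) ∧
          ∀ (S₀ : Type) [CommRing S₀] (a : unrIntegers p →+* S₀) (b : padicCoeffIntegers D.ι →+* S₀)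
            (j : ℤ_[p] →+* unrIntegers p),
            (∀ x : ℤ_[p], ((j x : unrIntegers p) : ℂ_[p]) = algebraMap ℚ_[p] ℂ_[p] (x : ℚ_[p])) →
            a.comp j = b.comp (algebraMap ℤ_[p] (padicCoeffIntegers D.ι)) →
            ∃ Lm : PowerSeries S₀,
              (XBig.charIdeal κ (D.Δ.cofreeRepOver K) 𝔭bar (↑(W.sigmaPlacesFinset p K))).map
                  (PowerSeries.map b) ≤ Ideal.span {Lm} ∧
              Ideal.span {Lm} ≤
                Ideal.span {PowerSeries.map a (L * PowerSeries.map j (W.sigmaEulerElement p K κ))} ⊔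
                  Ideal.span {((p : ℕ) : PowerSeries S₀) ^ m} := by
  have h' := h ι W K 𝔭 𝔭bar κ γ hf hN hp hmult hM hK hHeeg hsplit h𝔭 hcompat h𝔭bar hne hirr h2 hns hram
    htors hκ
  obtain ⟨ΩK, Ωp, L, hΩ, hL, hmem⟩ := h'
  refine ⟨ΩK, Ωp, L, hΩ, hL, fun m hm => ?_⟩
  obtain ⟨D, hD⟩ := hmem m hm
  refine ⟨D, ⟨hD.1, fun S₀ _ a b j hj hab => ?_⟩⟩
  obtain ⟨Lm, hCh, hc⟩ := hD.2 S₀ a b j hj hab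
  exact ⟨Lm, hCh, le_sup_left.trans hc.le⟩

end API

end Literature.NumberTheory.EllipticCurves.Castella2018

end
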